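import Mathlib

/-!
# `SnSubsetDichotomy.HyperoctahedralThreshold`, line `refutation-local-symmetry` — `stub_extract`

Extraction of a clean gadget shape from a closed colour-walk of rungs (crux
`stmt-MatrixMultiplication-10883`, registered stub `stub_extract` of the lead's skeleton for line
`refutation-local-symmetry`).

Setting: `μ 0, μ 1, μ 2` are fixed-point-free involutions of `Fin n`; a *rung* is an ordered pair
`(p i, q i)` of distinct points.  The hypothesis is a closed colour-walk of `k + 1` rungs indexed
cyclically by `Fin (k + 1)`: the colour `col i` maps the set `{p i, q i}` onto
`{p (i + 1), q (i + 1)}` (sides preserved or swapped), cyclically consecutive colours differ, and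
two rungs are equal as sets or disjoint.  The conclusion offers one of three clean shapes on
points of the walk: (1) a clean cycle, (2) a clean path between two loop-rungs, (3) a clean
Möbius cycle (the hypotheses of the sibling stubs `stub_cycleGadget`, `stub_pathGadget`,
`stub_mobiusGadget`).

Proof.  All indices are first transported to `ℕ` with period `k + 1` (`Extract.extract_nat`);
rung-sets are the elements `s(P i, Q i)` of `Sym2 (Fin n)`.
* `Extract.window_of_rep`: in an index interval without loops (`S i ≠ S (i + 1)`) containing a
  repetition of rung-sets, a repetition `S a = S (a + d + 2)` of minimal gap has pairwise distinct
  sets on `[a, a + d + 2)` and is cyclically non-backtracking (`C (a + d + 1) ≠ C a`): otherwise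
  applying that colour to `S a = S (a + d + 2)` gives the repetition `S (a + 1) = S (a + d + 1)`
  of gap `d`, which is a smaller gap (`d ≥ 2`), a loop (`d = 1`) or a backtrack `C (a + 1) = C a`
  (`d = 0`).
* `Extract.cycle_or_mobius`: relabel the two sides consistently along such a window (start with
  `(P a, Q a)` and apply the colours successively, `Extract.exists_iterate`); every step becomes
  side-preserving, all points are distinct (distinct rung-sets are disjoint, `Extract.iterate_ne`),
  and the closing step either preserves the sides — shape (1) — or swaps them — shape (3).
* `Extract.path_shape`: between a loop and the next loop, if the rung-sets are pairwise distinct,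
  the same relabelling gives shape (2); the two loop colours swap the two points of the end rungs
  because the `μ c` are fixed-point-free (`Extract.loop_swap`).
* `Extract.extract_nat`: if there is a loop, look at the segment up to the next loop (found with
  `Nat.find`, at distance `≤ k` by periodicity); either it is repetition-free (shape (2)) or
  `window_of_rep` applies inside it (shapes (1)/(3)); if there is no loop, `window_of_rep`
  applies to `[0, k + 1]` with the repetition `S 0 = S (k + 1)`.
-/

-- the tree's namespace `Summit.MatrixMultiplication.MatrixMultiplication.…` repeats a component
set_option linter.dupNamespace false

namespace Summit.MatrixMultiplication.MatrixMultiplication.Theorems.HyperoctahedralThreshold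

open Equiv Function

namespace Extract

/-- **Minimal-gap window.**  For a sequence `R` with no immediate repetition on `[lo, hi)`, a
colouring `C` without immediate repetition, the backtrack rule
`R a = R (a + d + 1) → C (a + d) = C a → R (a + 1) = R (a + d)`, and some repetition
`R a = R b` with `lo ≤ a < b ≤ hi`, there is a repetition `R a = R (a + d + 2)` inside
`[lo, hi]` with pairwise distinct values on `[a, a + d + 2)` and `C (a + d + 1) ≠ C a`.
[folklore] -/
theorem window_of_rep {α β : Type*} (R : ℕ → α) (C : ℕ → β) (lo hi : ℕ)
    (hnl : ∀ i, lo ≤ i → i < hi → R i ≠ R (i + 1))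
    (hnb : ∀ i, C i ≠ C (i + 1))
    (hback : ∀ a d, R a = R (a + d + 1) → C (a + d) = C a → R (a + 1) = R (a + d))
    (hrep : ∃ a b, lo ≤ a ∧ a < b ∧ b ≤ hi ∧ R a = R b) :
    ∃ a d, lo ≤ a ∧ a + d + 2 ≤ hi ∧ R a = R (a + d + 2) ∧
      (∀ i j, i < j → j < d + 2 → R (a + i) ≠ R (a + j)) ∧ C (a + d + 1) ≠ C a := by
  classical
  have hex : ∃ g, 1 ≤ g ∧ ∃ a, lo ≤ a ∧ a + g ≤ hi ∧ R a = R (a + g) := by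
    obtain ⟨a, b, h1, h2, h3, h4⟩ := hrep
    refine ⟨b - a, by omega, a, h1, by omega, ?_⟩
    rwa [Nat.add_sub_cancel' h2.le]
  obtain ⟨hg1, a, hlo, hhi, hR⟩ := Nat.find_spec hex
  have hmin : ∀ g', g' < Nat.find hex →
      ¬ (1 ≤ g' ∧ ∃ a, lo ≤ a ∧ a + g' ≤ hi ∧ R a = R (a + g')) :=
    fun g' h => Nat.find_min hex h
  have hg2 : 2 ≤ Nat.find hex := by
    by_contra h
    have h1 : Nat.find hex = 1 := by omega
    rw [h1] at hR
    exact hnl a hlo (by omega) hR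
  refine ⟨a, Nat.find hex - 2, hlo, by omega, ?_, ?_, ?_⟩
  · rwa [show a + (Nat.find hex - 2) + 2 = a + Nat.find hex by omega]
  · intro i j hij hj heq
    refine hmin (j - i) (by omega) ⟨by omega, a + i, by omega, by omega, ?_⟩
    rwa [show a + i + (j - i) = a + j by omega]
  · intro hc
    have hb : R (a + 1) = R (a + (Nat.find hex - 1)) := by
      refine hback a (Nat.find hex - 1) ?_ ?_
      · rwa [show a + (Nat.find hex - 1) + 1 = a + Nat.find hex by omega]
      · rwa [show a + (Nat.find hex - 1) = a + (Nat.find hex - 2) + 1 by omega]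
    rcases Nat.lt_or_ge (Nat.find hex) 4 with hg4 | hg4
    · rcases (show Nat.find hex = 2 ∨ Nat.find hex = 3 by omega) with h2 | h3
      · rw [show a + (Nat.find hex - 2) + 1 = a + 1 by omega] at hc
        exact hnb a hc.symm
      · rw [show a + (Nat.find hex - 1) = a + 1 + 1 by omega] at hb
        exact hnl (a + 1) (by omega) (by omega) hb
    · refine hmin (Nat.find hex - 2) (by omega) ⟨by omega, a + 1, by omega, by omega, ?_⟩
      rwa [show a + 1 + (Nat.find hex - 2) = a + (Nat.find hex - 1) by omega]

/-- Iterating the colours `C a, C (a + 1), …` from a point `x`: the relabelled side of the walk.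
[folklore] -/
theorem exists_iterate {n : ℕ} (μ : Fin 3 → Perm (Fin n)) (C : ℕ → Fin 3) (a : ℕ)
    (x : Fin n) : ∃ f : ℕ → Fin n, f 0 = x ∧ ∀ m, f (m + 1) = μ (C (a + m)) (f m) :=
  ⟨fun m => Nat.rec (motive := fun _ => Fin n) x (fun m y => μ (C (a + m)) y) m, rfl,
    fun _ => rfl⟩

variable {n : ℕ} (μ : Fin 3 → Perm (Fin n)) (P Q : ℕ → Fin n) (C : ℕ → Fin 3)
  (W : Fin n → Prop) (N : ℕ)
  (hfpf : ∀ c v, μ c v ≠ v) (hpq : ∀ i, P i ≠ Q i)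
  (hstep : ∀ i, (μ (C i) (P i) = P (i + 1) ∧ μ (C i) (Q i) = Q (i + 1)) ∨
    (μ (C i) (P i) = Q (i + 1) ∧ μ (C i) (Q i) = P (i + 1)))
  (hnb : ∀ i, C i ≠ C (i + 1))
  (hdisj : ∀ i j, s(P i, Q i) = s(P j, Q j) ∨
    (P i ≠ P j ∧ P i ≠ Q j ∧ Q i ≠ P j ∧ Q i ≠ Q j)) (hW : ∀ i, W (P i) ∧ W (Q i))

include hstep in
/-- The relabelled sides `(f m, g m)` started at `(P a, Q a)` form the rung `a + m`, possibly with
its two sides exchanged. [folklore] -/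
theorem iterate_spec (a : ℕ) (f g : ℕ → Fin n) (hf0 : f 0 = P a) (hg0 : g 0 = Q a)
    (hfs : ∀ m, f (m + 1) = μ (C (a + m)) (f m)) (hgs : ∀ m, g (m + 1) = μ (C (a + m)) (g m))
    (m : ℕ) :
    (f m = P (a + m) ∧ g m = Q (a + m)) ∨ (f m = Q (a + m) ∧ g m = P (a + m)) := by
  induction m with
  | zero => exact Or.inl ⟨hf0, hg0⟩
  | succ m ih =>
    rw [hfs, hgs, show a + (m + 1) = a + m + 1 from rfl]
    rcases ih with ⟨h1, h2⟩ | ⟨h1, h2⟩ <;>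
      rcases hstep (a + m) with ⟨h3, h4⟩ | ⟨h3, h4⟩
    · exact Or.inl ⟨by rw [h1, h3], by rw [h2, h4]⟩
    · exact Or.inr ⟨by rw [h1, h3], by rw [h2, h4]⟩
    · exact Or.inr ⟨by rw [h1, h4], by rw [h2, h3]⟩
    · exact Or.inl ⟨by rw [h1, h4], by rw [h2, h3]⟩

include hstep in
/-- The relabelled sides form the same rung-sets as the walk. [folklore] -/
theorem iterate_sym2 (a : ℕ) (f g : ℕ → Fin n) (hf0 : f 0 = P a) (hg0 : g 0 = Q a)
    (hfs : ∀ m, f (m + 1) = μ (C (a + m)) (f m)) (hgs : ∀ m, g (m + 1) = μ (C (a + m)) (g m))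
    (m : ℕ) : s(f m, g m) = s(P (a + m), Q (a + m)) := by
  rcases iterate_spec μ P Q C hstep a f g hf0 hg0 hfs hgs m with ⟨h1, h2⟩ | ⟨h1, h2⟩
  · rw [h1, h2]
  · rw [h1, h2, Sym2.eq_swap]

include hstep hW in
/-- The relabelled points are points of the walk (abstract predicate `W`). [folklore] -/
theorem iterate_mem (a : ℕ) (f g : ℕ → Fin n) (hf0 : f 0 = P a) (hg0 : g 0 = Q a)
    (hfs : ∀ m, f (m + 1) = μ (C (a + m)) (f m)) (hgs : ∀ m, g (m + 1) = μ (C (a + m)) (g m))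
    (m : ℕ) : W (f m) ∧ W (g m) := by
  rcases iterate_spec μ P Q C hstep a f g hf0 hg0 hfs hgs m with ⟨h1, h2⟩ | ⟨h1, h2⟩ <;>
    rw [h1, h2]
  exacts [hW _, ⟨(hW _).2, (hW _).1⟩]

include hfpf hstep in
/-- **A loop swaps its rung.**  If the step of colour `C i` maps the rung-set `i` to itself, then
`μ (C i)` exchanges the two points of that rung (the `μ c` are fixed-point-free). [folklore] -/
theorem loop_swap (i : ℕ) (hl : s(P i, Q i) = s(P (i + 1), Q (i + 1))) (x y : Fin n)
    (hxy : s(x, y) = s(P (i + 1), Q (i + 1))) : μ (C i) x = y ∧ μ (C i) y = x := by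
  have key : μ (C i) (P (i + 1)) = Q (i + 1) ∧ μ (C i) (Q (i + 1)) = P (i + 1) := by
    rcases Sym2.eq_iff.1 hl with ⟨h1, h2⟩ | ⟨h1, h2⟩ <;>
      rcases hstep i with ⟨h3, h4⟩ | ⟨h3, h4⟩ <;> rw [h1] at h3 <;> rw [h2] at h4
    exacts [absurd h3 (hfpf _ _), ⟨h3, h4⟩, ⟨h4, h3⟩, absurd h3 (hfpf _ _)]
  rcases Sym2.eq_iff.1 hxy with ⟨rfl, rfl⟩ | ⟨rfl, rfl⟩
  · exact key
  · exact ⟨key.2, key.1⟩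

include hpq hstep hdisj in
/-- **Distinctness after relabelling.**  If the rung-sets of the window `[a, a + L)` are pairwise
distinct (hence pairwise disjoint), the relabelled sides `f`, `g` are injective on `[0, L)` with
disjoint images. [folklore] -/
theorem iterate_ne (a : ℕ) (f g : ℕ → Fin n) (hf0 : f 0 = P a) (hg0 : g 0 = Q a)
    (hfs : ∀ m, f (m + 1) = μ (C (a + m)) (f m)) (hgs : ∀ m, g (m + 1) = μ (C (a + m)) (g m))
    (L : ℕ) {i j : ℕ} (hi : i < L) (hj : j < L)
    (hwin : ∀ i j, i < j → j < L → s(P (a + i), Q (a + i)) ≠ s(P (a + j), Q (a + j))) :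
    (f i = f j → i = j) ∧ (g i = g j → i = j) ∧ f i ≠ g j := by
  have hs := iterate_spec μ P Q C hstep a f g hf0 hg0 hfs hgs
  have key : ∀ i j, i < j → j < L → f i ≠ f j ∧ f i ≠ g j ∧ g i ≠ f j ∧ g i ≠ g j := by
    intro i j hij hjL
    obtain ⟨n1, n2, n3, n4⟩ := (hdisj (a + i) (a + j)).resolve_left (hwin i j hij hjL)
    rcases hs i with ⟨h1, h2⟩ | ⟨h1, h2⟩ <;> rcases hs j with ⟨h3, h4⟩ | ⟨h3, h4⟩ <;>
      rw [h1, h2, h3, h4]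
    exacts [⟨n1, n2, n3, n4⟩, ⟨n2, n1, n4, n3⟩, ⟨n3, n4, n1, n2⟩, ⟨n4, n3, n2, n1⟩]
  rcases lt_trichotomy i j with h | rfl | h
  · obtain ⟨n1, n2, -, n4⟩ := key i j h hj
    exact ⟨fun e => (n1 e).elim, fun e => (n4 e).elim, n2⟩
  · refine ⟨fun _ => rfl, fun _ => rfl, ?_⟩
    rcases hs i with ⟨h1, h2⟩ | ⟨h1, h2⟩ <;> rw [h1, h2]
    exacts [hpq _, (hpq _).symm]
  · obtain ⟨n1, -, n3, n4⟩ := key j i h hi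
    exact ⟨fun e => (n1 e.symm).elim, fun e => (n4 e.symm).elim, fun e => n3 e.symm⟩

include hpq hstep hnb hdisj hW in
/-- **Shapes (1) and (3).**  A window `[a, a + d + 2]` of the walk which closes up
(`S a = S (a + d + 2)`), has pairwise distinct rung-sets on `[a, a + d + 2)` and is cyclically
non-backtracking yields, after consistent relabelling of the sides, a clean cycle (the closing
step preserves the sides) or a clean Möbius cycle (it swaps them). [folklore] -/
theorem cycle_or_mobius (a d : ℕ) (hdN : d + 2 ≤ N)
    (hclose : s(P a, Q a) = s(P (a + d + 2), Q (a + d + 2)))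
    (hwin : ∀ i j, i < j → j < d + 2 → s(P (a + i), Q (a + i)) ≠ s(P (a + j), Q (a + j)))
    (hcyc : C (a + d + 1) ≠ C a) :
    (∃ (k' : ℕ) (p' q' : Fin (k' + 2) → Fin n) (col' : Fin (k' + 2) → Fin 3),
      Injective p' ∧ Injective q' ∧ (∀ i j, p' i ≠ q' j) ∧
      (∀ i, μ (col' i) (p' i) = p' (i + 1) ∧ μ (col' i) (q' i) = q' (i + 1)) ∧
      (∀ i, col' i ≠ col' (i + 1)) ∧ (∀ i, W (p' i) ∧ W (q' i)) ∧ k' + 2 ≤ N) ∨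
    (∃ (k' : ℕ) (p' q' : Fin (k' + 2) → Fin n) (col' : Fin (k' + 2) → Fin 3),
      Injective p' ∧ Injective q' ∧ (∀ i j, p' i ≠ q' j) ∧
      (∀ j : Fin (k' + 1), μ (col' j.castSucc) (p' j.castSucc) = p' j.succ ∧
        μ (col' j.castSucc) (q' j.castSucc) = q' j.succ) ∧
      μ (col' (Fin.last (k' + 1))) (p' (Fin.last (k' + 1))) = q' 0 ∧
      μ (col' (Fin.last (k' + 1))) (q' (Fin.last (k' + 1))) = p' 0 ∧
      (∀ i : Fin (k' + 1), col' i.castSucc ≠ col' i.succ) ∧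
      col' (Fin.last (k' + 1)) ≠ col' 0 ∧ (∀ i, W (p' i) ∧ W (q' i)) ∧ k' + 2 ≤ N) := by
  obtain ⟨f, hf0, hfs⟩ := exists_iterate μ C a (P a)
  obtain ⟨g, hg0, hgs⟩ := exists_iterate μ C a (Q a)
  have hne := fun i j (hi : i < d + 2) (hj : j < d + 2) =>
    iterate_ne μ P Q C hpq hstep hdisj a f g hf0 hg0 hfs hgs (d + 2) hi hj hwin
  have hinjP : Injective (fun i : Fin (d + 2) => f i.val) :=
    fun i j h => Fin.ext ((hne i.val j.val i.2 j.2).1 h)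
  have hinjQ : Injective (fun i : Fin (d + 2) => g i.val) :=
    fun i j h => Fin.ext ((hne i.val j.val i.2 j.2).2.1 h)
  have hPQ : ∀ i j : Fin (d + 2), f i.val ≠ g j.val := fun i j => (hne i.val j.val i.2 j.2).2.2
  have hWi : ∀ i : Fin (d + 2), W (f i.val) ∧ W (g i.val) :=
    fun i => iterate_mem μ P Q C W hstep hW a f g hf0 hg0 hfs hgs i.val
  have hcols : ∀ i : Fin (d + 1), C (a + i.castSucc.val) ≠ C (a + i.succ.val) := fun i => by
    simp only [Fin.val_castSucc, Fin.val_succ]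
    exact hnb (a + i)
  have hcyc' : C (a + (d + 1)) ≠ C (a + 0) := hcyc
  -- the closing step, from rung `a + d + 1` back to rung `a + d + 2 = a` as a set
  have hlast : s(μ (C (a + (d + 1))) (f (d + 1)), μ (C (a + (d + 1))) (g (d + 1))) =
      s(f 0, g 0) := by
    rw [← hfs, ← hgs, iterate_sym2 μ P Q C hstep a f g hf0 hg0 hfs hgs (d + 1 + 1), hf0, hg0,
      hclose, show a + (d + 1 + 1) = a + d + 2 by omega]
  rcases Sym2.eq_iff.1 hlast with ⟨hp, hq⟩ | ⟨hp, hq⟩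
  · left
    refine ⟨d, fun i => f i.val, fun i => g i.val, fun i => C (a + i.val), hinjP, hinjQ, hPQ,
      ?_, ?_, hWi, hdN⟩
    · intro i
      rcases Fin.eq_castSucc_or_eq_last i with ⟨j, rfl⟩ | rfl
      · simp only [Fin.coeSucc_eq_succ, Fin.val_castSucc, Fin.val_succ]
        exact ⟨(hfs j).symm, (hgs j).symm⟩
      · simp only [Fin.last_add_one, Fin.val_last, Fin.val_zero]
        exact ⟨hp, hq⟩
    · intro i
      rcases Fin.eq_castSucc_or_eq_last i with ⟨j, rfl⟩ | rfl
      · simp only [Fin.coeSucc_eq_succ, Fin.val_castSucc, Fin.val_succ]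
        exact hnb (a + j)
      · simpa only [Fin.last_add_one, Fin.val_last, Fin.val_zero] using hcyc'
  · right
    refine ⟨d, fun i => f i.val, fun i => g i.val, fun i => C (a + i.val), hinjP, hinjQ, hPQ,
      ?_, ?_, ?_, hcols, ?_, hWi, hdN⟩
    · intro j
      simp only [Fin.val_castSucc, Fin.val_succ]
      exact ⟨(hfs j).symm, (hgs j).symm⟩
    · simpa only [Fin.val_last, Fin.val_zero] using hp
    · simpa only [Fin.val_last, Fin.val_zero] using hq
    · simpa only [Fin.val_last, Fin.val_zero] using hcyc'

include hfpf hpq hstep hnb hdisj hW in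
/-- **Shape (2).**  The segment of the walk from the rung after a loop (at `i₀`) up to the next
loop (at `i₀ + 1 + m₀`), if its rung-sets are pairwise distinct, yields after consistent
relabelling a clean path between two loop-rungs. [folklore] -/
theorem path_shape (i₀ m₀ : ℕ) (hmN : m₀ + 1 ≤ N)
    (hl0 : s(P i₀, Q i₀) = s(P (i₀ + 1), Q (i₀ + 1)))
    (hl1 : s(P (i₀ + 1 + m₀), Q (i₀ + 1 + m₀)) =
      s(P (i₀ + 1 + m₀ + 1), Q (i₀ + 1 + m₀ + 1)))
    (hwin : ∀ i j, i < j → j < m₀ + 1 →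
      s(P (i₀ + 1 + i), Q (i₀ + 1 + i)) ≠ s(P (i₀ + 1 + j), Q (i₀ + 1 + j))) :
    ∃ (k' : ℕ) (p' q' : Fin (k' + 1) → Fin n) (col' : Fin (k' + 2) → Fin 3),
      Injective p' ∧ Injective q' ∧ (∀ i j, p' i ≠ q' j) ∧ μ (col' 0) (p' 0) = q' 0 ∧
      μ (col' (Fin.last (k' + 1))) (p' (Fin.last k')) = q' (Fin.last k') ∧
      (∀ j : Fin k', μ (col' j.succ.castSucc) (p' j.castSucc) = p' j.succ ∧
        μ (col' j.succ.castSucc) (q' j.castSucc) = q' j.succ) ∧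
      (∀ i : Fin (k' + 1), col' i.castSucc ≠ col' i.succ) ∧
      (∀ i, W (p' i) ∧ W (q' i)) ∧ k' + 1 ≤ N := by
  obtain ⟨f, hf0, hfs⟩ := exists_iterate μ C (i₀ + 1) (P (i₀ + 1))
  obtain ⟨g, hg0, hgs⟩ := exists_iterate μ C (i₀ + 1) (Q (i₀ + 1))
  have hne := fun i j (hi : i < m₀ + 1) (hj : j < m₀ + 1) =>
    iterate_ne μ P Q C hpq hstep hdisj (i₀ + 1) f g hf0 hg0 hfs hgs (m₀ + 1) hi hj hwin
  refine ⟨m₀, fun i => f i.val, fun i => g i.val, fun i => C (i₀ + i.val),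
    fun i j h => Fin.ext ((hne i.val j.val i.2 j.2).1 h),
    fun i j h => Fin.ext ((hne i.val j.val i.2 j.2).2.1 h),
    fun i j => (hne i.val j.val i.2 j.2).2.2, ?_, ?_, ?_, ?_,
    fun i => iterate_mem μ P Q C W hstep hW (i₀ + 1) f g hf0 hg0 hfs hgs i.val, hmN⟩
  · -- the loop colour `C i₀` swaps the two points of rung `i₀ + 1`
    simp only [Fin.val_zero, Nat.add_zero, hf0, hg0]
    exact (loop_swap μ P Q C hfpf hstep i₀ hl0 (P (i₀ + 1)) (Q (i₀ + 1)) rfl).1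
  · -- the loop colour `C (i₀ + 1 + m₀)` swaps the two points of the last rung
    simp only [Fin.val_last]
    rw [show i₀ + (m₀ + 1) = i₀ + 1 + m₀ by omega]
    exact (loop_swap μ P Q C hfpf hstep (i₀ + 1 + m₀) hl1 (f m₀) (g m₀)
      ((iterate_sym2 μ P Q C hstep (i₀ + 1) f g hf0 hg0 hfs hgs m₀).trans hl1)).1
  · intro j
    simp only [Fin.val_castSucc, Fin.val_succ]
    rw [show i₀ + (j.val + 1) = i₀ + 1 + j.val by omega]
    exact ⟨(hfs j).symm, (hgs j).symm⟩
  · intro i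
    simp only [Fin.val_castSucc, Fin.val_succ]
    exact hnb (i₀ + i)

include hfpf hpq hstep hnb hdisj hW in
/-- **The extraction over `ℕ`-indexed periodic data.**  A closed colour-walk given as
`ℕ`-indexed sequences of period `N ≥ 1` (rungs `(P i, Q i)`, colours `C i`) with the
hypotheses of `stub_extract` contains a clean cycle, a clean path between two loop-rungs, or a
clean Möbius cycle, on points satisfying `W` and with at most `N` rungs. [folklore] -/
theorem extract_nat (hN : 1 ≤ N) (hinv : ∀ c v, μ c (μ c v) = v)
    (hper : ∀ i, P (i + N) = P i ∧ Q (i + N) = Q i) :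
    (∃ (k' : ℕ) (p' q' : Fin (k' + 2) → Fin n) (col' : Fin (k' + 2) → Fin 3),
      Injective p' ∧ Injective q' ∧ (∀ i j, p' i ≠ q' j) ∧
      (∀ i, μ (col' i) (p' i) = p' (i + 1) ∧ μ (col' i) (q' i) = q' (i + 1)) ∧
      (∀ i, col' i ≠ col' (i + 1)) ∧ (∀ i, W (p' i) ∧ W (q' i)) ∧ k' + 2 ≤ N) ∨
    (∃ (k' : ℕ) (p' q' : Fin (k' + 1) → Fin n) (col' : Fin (k' + 2) → Fin 3),
      Injective p' ∧ Injective q' ∧ (∀ i j, p' i ≠ q' j) ∧ μ (col' 0) (p' 0) = q' 0 ∧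
      μ (col' (Fin.last (k' + 1))) (p' (Fin.last k')) = q' (Fin.last k') ∧
      (∀ j : Fin k', μ (col' j.succ.castSucc) (p' j.castSucc) = p' j.succ ∧
        μ (col' j.succ.castSucc) (q' j.castSucc) = q' j.succ) ∧
      (∀ i : Fin (k' + 1), col' i.castSucc ≠ col' i.succ) ∧
      (∀ i, W (p' i) ∧ W (q' i)) ∧ k' + 1 ≤ N) ∨
    (∃ (k' : ℕ) (p' q' : Fin (k' + 2) → Fin n) (col' : Fin (k' + 2) → Fin 3),
      Injective p' ∧ Injective q' ∧ (∀ i j, p' i ≠ q' j) ∧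
      (∀ j : Fin (k' + 1), μ (col' j.castSucc) (p' j.castSucc) = p' j.succ ∧
        μ (col' j.castSucc) (q' j.castSucc) = q' j.succ) ∧
      μ (col' (Fin.last (k' + 1))) (p' (Fin.last (k' + 1))) = q' 0 ∧
      μ (col' (Fin.last (k' + 1))) (q' (Fin.last (k' + 1))) = p' 0 ∧
      (∀ i : Fin (k' + 1), col' i.castSucc ≠ col' i.succ) ∧
      col' (Fin.last (k' + 1)) ≠ col' 0 ∧ (∀ i, W (p' i) ∧ W (q' i)) ∧ k' + 2 ≤ N) := by
  classical
  have hmap : ∀ i, Sym2.map (μ (C i)) s(P i, Q i) = s(P (i + 1), Q (i + 1)) := fun i => by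
    rcases hstep i with ⟨h1, h2⟩ | ⟨h1, h2⟩
    · rw [Sym2.map_mk, h1, h2]
    · rw [Sym2.map_mk, h1, h2, Sym2.eq_swap]
  have hback : ∀ a d, s(P a, Q a) = s(P (a + d + 1), Q (a + d + 1)) → C (a + d) = C a →
      s(P (a + 1), Q (a + 1)) = s(P (a + d), Q (a + d)) := by
    intro a d hR hc
    rw [← hmap a, hR, ← hmap (a + d), hc, Sym2.map_mk, Sym2.map_mk, hinv, hinv]
  by_cases hloop : ∃ i₀, s(P i₀, Q i₀) = s(P (i₀ + 1), Q (i₀ + 1))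
  · obtain ⟨i₀, hl0⟩ := hloop
    -- the next loop after `i₀` is at `i₀ + 1 + m₀` with `m₀ := Nat.find hex ≤ N - 1`
    have hwit : s(P (i₀ + 1 + (N - 1)), Q (i₀ + 1 + (N - 1))) =
        s(P (i₀ + 1 + (N - 1) + 1), Q (i₀ + 1 + (N - 1) + 1)) := by
      have e1 : i₀ + 1 + (N - 1) = i₀ + N := by omega
      have e2 : i₀ + N + 1 = i₀ + 1 + N := by omega
      rw [e1, e2, (hper i₀).1, (hper i₀).2, (hper (i₀ + 1)).1, (hper (i₀ + 1)).2]
      exact hl0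
    have hex : ∃ m, s(P (i₀ + 1 + m), Q (i₀ + 1 + m)) =
        s(P (i₀ + 1 + m + 1), Q (i₀ + 1 + m + 1)) := ⟨N - 1, hwit⟩
    have hm₀N : Nat.find hex ≤ N - 1 := Nat.find_min' hex hwit
    have hnl : ∀ i, i₀ + 1 ≤ i → i < i₀ + 1 + Nat.find hex →
        s(P i, Q i) ≠ s(P (i + 1), Q (i + 1)) := by
      intro i h1 h2 heq
      have h3 := Nat.find_min hex (show i - (i₀ + 1) < Nat.find hex by omega)
      rw [show i₀ + 1 + (i - (i₀ + 1)) = i by omega] at h3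
      exact h3 heq
    by_cases hwin : ∀ i j, i < j → j < Nat.find hex + 1 →
        s(P (i₀ + 1 + i), Q (i₀ + 1 + i)) ≠ s(P (i₀ + 1 + j), Q (i₀ + 1 + j))
    · exact Or.inr (Or.inl (path_shape μ P Q C W N hfpf hpq hstep hnb hdisj hW i₀ (Nat.find hex)
        (by omega) hl0 (Nat.find_spec hex) hwin))
    · push Not at hwin
      obtain ⟨i, j, hij, hj, heq⟩ := hwin
      obtain ⟨a, d, hlo, hhi, hcl, hw, hcyc⟩ := window_of_rep (fun m => s(P m, Q m)) C
        (i₀ + 1) (i₀ + 1 + Nat.find hex) hnl hnb hback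
        ⟨i₀ + 1 + i, i₀ + 1 + j, by omega, by omega, by omega, heq⟩
      rcases cycle_or_mobius μ P Q C W N hpq hstep hnb hdisj hW a d (by omega) hcl hw hcyc with
        h | h
      · exact Or.inl h
      · exact Or.inr (Or.inr h)
  · push Not at hloop
    have h0 : s(P 0, Q 0) = s(P N, Q N) := by
      have h := hper 0
      rw [Nat.zero_add] at h
      rw [h.1, h.2]
    obtain ⟨a, d, -, hhi, hcl, hw, hcyc⟩ := window_of_rep (fun m => s(P m, Q m)) C 0 N
      (fun i _ _ => hloop i) hnb hback ⟨0, N, le_rfl, hN, le_rfl, h0⟩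
    rcases cycle_or_mobius μ P Q C W N hpq hstep hnb hdisj hW a d (by omega) hcl hw hcyc with
      h | h
    · exact Or.inl h
    · exact Or.inr (Or.inr h)

end Extract

open Fin.NatCast in
/-- **Extraction of a clean shape** (stub `stub_extract` of line `refutation-local-symmetry`):
a closed colour-walk of rungs of the three fixed-point-free involutions `μ 0, μ 1, μ 2` —
cyclically indexed by `Fin (k + 1)`, each step mapping a rung onto the next with sides preserved
or swapped, cyclically non-backtracking colours, rungs pairwise equal-or-disjoint — contains, on
points of the walk and with at most `k + 1` rungs, a clean cycle, a clean path between two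
loop-rungs, or a clean Möbius cycle. [folklore] -/
theorem stub_extract : ∀ (n k : ℕ) (μ : Fin 3 → Equiv.Perm (Fin n)) (p q : Fin (k + 1) → Fin n) (col : Fin (k + 1) → Fin 3), (∀ c, μ c * μ c = 1) → (∀ c v, μ c v ≠ v) → (∀ i, p i ≠ q i) → (∀ i, (μ (col i) (p i) = p (i + 1) ∧ μ (col i) (q i) = q (i + 1)) ∨ (μ (col i) (p i) = q (i + 1) ∧ μ (col i) (q i) = p (i + 1))) → (∀ i, col i ≠ col (i + 1)) → (∀ i j, (p i = p j ∧ q i = q j) ∨ (p i = q j ∧ q i = p j) ∨ (p i ≠ p j ∧ p i ≠ q j ∧ q i ≠ p j ∧ q i ≠ q j)) → (∃ (k' : ℕ) (p' q' : Fin (k' + 2) → Fin n) (col' : Fin (k' + 2) → Fin 3), Function.Injective p' ∧ Function.Injective q' ∧ (∀ i j, p' i ≠ q' j) ∧ (∀ i, μ (col' i) (p' i) = p' (i + 1) ∧ μ (col' i) (q' i) = q' (i + 1)) ∧ (∀ i, col' i ≠ col' (i + 1)) ∧ (∀ i, (∃ j, p' i = p j ∨ p' i = q j) ∧ (∃ j,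 q' i = p j ∨ q' i = q j)) ∧ k' + 2 ≤ k + 1) ∨ (∃ (k' : ℕ) (p' q' : Fin (k' + 1) → Fin n) (col' : Fin (k' + 2) → Fin 3), Function.Injective p' ∧ Function.Injective q' ∧ (∀ i j, p' i ≠ q' j) ∧ μ (col' 0) (p' 0) = q' 0 ∧ μ (col' (Fin.last (k' + 1))) (p' (Fin.last k')) = q' (Fin.last k') ∧ (∀ j : Fin k', μ (col' j.succ.castSucc) (p' j.castSucc) = p' j.succ ∧ μ (col' j.succ.castSucc) (q' j.castSucc) = q' j.succ) ∧ (∀ i : Fin (k' + 1), col' i.castSucc ≠ col' i.succ) ∧ (∀ i, (∃ j, p' i = p j ∨ p' i = q j) ∧ (∃ j, q' i = p j ∨ q' i = q j)) ∧ k' + 1 ≤ k + 1) ∨ (∃ (k' : ℕ) (p' q' : Fin (k' + 2) → Fin n) (col' : Fin (k' + 2) → Fin 3), Function.Injective p' ∧ Function.Injective q' ∧ (∀ i j, p' i ≠ q' j) ∧ (∀ j : Fin (k' + 1), μ (col' j.castSucc) (p' j.castSucc) = p' j.succ ∧ μ (col' j.castSucc) (q' j.castSucc) = q' j.succ) ∧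 μ (col' (Fin.last (k' + 1))) (p' (Fin.last (k' + 1))) = q' 0 ∧ μ (col' (Fin.last (k' + 1))) (q' (Fin.last (k' + 1))) = p' 0 ∧ (∀ i : Fin (k' + 1), col' i.castSucc ≠ col' i.succ) ∧ col' (Fin.last (k' + 1)) ≠ col' 0 ∧ (∀ i, (∃ j, p' i = p j ∨ p' i = q j) ∧ (∃ j, q' i = p j ∨ q' i = q j)) ∧ k' + 2 ≤ k + 1) := by
  intro n k μ p q col hinv hfpf hpq hstep hnb hdisj
  have hinv' : ∀ c v, μ c (μ c v) = v := fun c v => by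
    simpa only [Perm.mul_apply, Perm.one_apply] using
      congrArg (fun f : Equiv.Perm (Fin n) => f v) (hinv c)
  have hsucc : ∀ m : ℕ, ((m + 1 : ℕ) : Fin (k + 1)) = (m : Fin (k + 1)) + 1 := fun m =>
    Nat.cast_succ m
  have hperN : ∀ m : ℕ, ((m + (k + 1) : ℕ) : Fin (k + 1)) = (m : Fin (k + 1)) := fun m => by
    rw [Nat.cast_add, Fin.natCast_self, add_zero]
  exact Extract.extract_nat μ (fun m => p m) (fun m => q m) (fun m => col m)
    (fun x => ∃ j, x = p j ∨ x = q j) (k + 1) hfpf (fun i => hpq _)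
    (fun i => by simpa only [← hsucc] using hstep (i : Fin (k + 1)))
    (fun i => by simpa only [← hsucc] using hnb (i : Fin (k + 1)))
    (fun i j => (or_assoc.mpr (hdisj i j)).imp_left Sym2.eq_iff.mpr)
    (fun i => ⟨⟨i, Or.inl rfl⟩, ⟨i, Or.inr rfl⟩⟩) (Nat.succ_pos k) hinv'
    (fun i => ⟨by rw [hperN], by rw [hperN]⟩)

end Summit.MatrixMultiplication.MatrixMultiplication.Theorems.HyperoctahedralThreshold
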